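import Summits.NavierStokesRegularity.FluidComputer.CascadeWitnessAnatomy
import Summits.NavierStokesRegularity.FluidComputer.SelfSimilarFace
import Summits.NavierStokesRegularity.FluidComputer.TypeIConcentrationFace
import Summits.NavierStokesRegularity.FluidComputer.AnisotropyFace
import Summits.NavierStokesRegularity.FluidComputer.VorticitySerrinFace
import Summits.NavierStokesRegularity.FluidComputer.TypeIDirectionFace
import Summits.NavierStokesRegularity.FluidComputer.ContinuationFace
import HarnessLib

/-!
# Fluid computer — the profile / Type-I / anisotropy / vorticity / continuation faces READ ON THE INTERFACE (II)

HONEST FRAMING (cell `pub-fluidc`, verbatim): *low prior, high value-of-information experiment on Tao's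
machine paradigm; NOT a claim that NS blows up.* An implication from the cell's (uninhabited, as far as anyone
knows) interface structure `CascadeWitness`; nothing here is evidence of blow-up. Companion of
`CascadeWitnessProfile` (L37–L41) and `BlowupProfile.blowup_profile_of_cascadeWitness`: every `W : CascadeWitness`
yields (via `x5a_of_cascadeWitness'`) `ν > 0`, `T > 0` and a maximal smooth Leray–Hopf solution `(u, p)`, hence

* `selfSimilar_face_of_cascadeWitness` — it is not backward (discretely) self-similar about `(T, x₀)` on any
  terminal window, any centre, any factor `λ > 1` (L42);
* `anisotropy_face_of_cascadeWitness` — no component gradient `∇u₃` and no directional derivative `∂₃u` stays in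
  its Serrin class on any terminal window (L45);
* `vorticity_serrin_face_of_cascadeWitness` — its vorticity lies in no `L^q_tL^r_x`, `2/q + 3/r = 2`, `1 < q < ∞`,
  on any terminal window (L47′);
* `typeI_faces_of_cascadeWitness` — it has a focus `x₀` at which (L43) a Morrey Type-I bound forces
  `γν < ‖u(t)‖_{L³(B̄(x₀, 2√(ν(T−t)/S)))}` for all late `t`, and (L49) a local Type-I bound forces the vorticity
  direction to have no modulus of continuity over the intense set near `x₀`;
* `continuation_face_of_cascadeWitness` — it is the pre-blow-up piece of a global Leray–Hopf continuation whose
  singular times form an `ℋ^{1/2}`-null set, `T` among them (L50).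

0 sorry; no new definitions, no named facts.

## References

* G. Seregin, Comm. Math. Phys. 312 (2012) 833–845. [Seregin2012]
* P. G. Lemarié-Rieusset, CRC 2016, §11.5. [LemarieRieusset2016]
* H. Beirão da Veiga, Chinese Ann. Math. Ser. B 16 (1995) 407–412. [BeiraoDaVeiga1995]
* T. Barker, C. Prange, Arch. Ration. Mech. Anal. 236 (2020). [BarkerPrange2020]
* Y. Giga, H. Miura, Comm. Math. Phys. 303 (2011) 289–300. [GigaMiura2011]
* J. Leray, Acta Math. 63 (1934) 193–248. [Leray1934]
-/

noncomputable section

open MeasureTheory Set Function Filter Topology Metric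
open scoped ENNReal NNReal
open Literature.Analysis.FluidPDE Literature.Analysis.FunctionSpaces Literature.Analysis.FluidPDE.FluidComputer
open Summit.NavierStokesRegularity.NavierStokesRegularity.Theorems.FluidComputer (x5a_of_cascadeWitness')
open Summit.NavierStokesRegularity.FluidComputer.SelfSimilarFace
open Summit.NavierStokesRegularity.FluidComputer.TypeIConcentrationFace
open Summit.NavierStokesRegularity.FluidComputer.AnisotropyFace
open Summit.NavierStokesRegularity.FluidComputer.VorticitySerrinFace
open Summit.NavierStokesRegularity.FluidComputer.TypeIDirectionFace
open Summit.NavierStokesRegularity.FluidComputer.ContinuationFace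

namespace Summit.NavierStokesRegularity.FluidComputer.CascadeWitnessProfileB

/-- **No cascade witness is backward (discretely) self-similar** (L42 on the interface). [cite: Seregin2012, Thm. 1.1] -/
theorem selfSimilar_face_of_cascadeWitness (W : CascadeWitness) :
    ∃ ν : ℝ, 0 < ν ∧ ∃ T : ℝ, 0 < T ∧
      ∃ (u : ℝ → EuclideanSpace ℝ (Fin 3) → EuclideanSpace ℝ (Fin 3))
        (p : ℝ → EuclideanSpace ℝ (Fin 3) → ℝ),
        IsMaximalSmoothSolution ν 0 u p T ∧ IsLerayHopfOn T ν 0 (u 0) u ∧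
        ∀ (x₀ : EuclideanSpace ℝ (Fin 3)) (l : ℝ), 1 < l → ∀ t₀ ∈ Ico 0 T,
          ¬ ∀ s ∈ Ioo t₀ T, ∀ x : EuclideanSpace ℝ (Fin 3),
              u (T - (T - s) / l ^ 2) x = l • u s (x₀ + l • (x - x₀)) := by
  obtain ⟨ν, hν, T, hT, u, p, hmax, hLH, -⟩ := x5a_of_cascadeWitness' W
  exact ⟨ν, hν, T, hT, u, p, hmax, hLH, fun x₀ l hl t₀ ht₀ => not_backward_dss hν hT hmax hLH x₀ hl ht₀⟩

/-- **No component and no direction of a cascade witness stays tame** (L45 on the interface).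
[cite: LemarieRieusset2016, Props. 11.5–11.6] -/
theorem anisotropy_face_of_cascadeWitness (W : CascadeWitness) :
    ∃ ν : ℝ, 0 < ν ∧ ∃ T : ℝ, 0 < T ∧
      ∃ (u : ℝ → EuclideanSpace ℝ (Fin 3) → EuclideanSpace ℝ (Fin 3))
        (p : ℝ → EuclideanSpace ℝ (Fin 3) → ℝ),
        IsMaximalSmoothSolution ν 0 u p T ∧ IsLerayHopfOn T ν 0 (u 0) u ∧
        (∀ (q r : ℝ≥0∞), 2 ≤ q → q < ⊤ → 2 / q + 3 / r = 3 / 2 → ∀ t₀ ∈ Ico 0 T,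
            ¬ MemLqLp q r (fun t x => fderiv ℝ (fun y => u t y 2) x) (Ioo t₀ T)) ∧
        ∀ (q r : ℝ≥0∞), 2 ≤ q → q ≤ 3 → 2 / q + 3 / r = 2 → ∀ t₀ ∈ Ico 0 T,
            ¬ MemLqLp q r (fun t x => fderiv ℝ (u t) x (EuclideanSpace.single 2 (1 : ℝ))) (Ioo t₀ T) := by
  obtain ⟨ν, hν, T, hT, u, p, hmax, hLH, -⟩ := x5a_of_cascadeWitness' W
  exact ⟨ν, hν, T, hT, u, p, hmax, hLH, anisotropy_face hν hmax hLH⟩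

/-- **The vorticity of a cascade witness leaves every Serrin class on every terminal window** (L47′ on the
interface). [cite: BeiraoDaVeiga1995, Thm 1] -/
theorem vorticity_serrin_face_of_cascadeWitness (W : CascadeWitness) :
    ∃ ν : ℝ, 0 < ν ∧ ∃ T : ℝ, 0 < T ∧
      ∃ (u : ℝ → EuclideanSpace ℝ (Fin 3) → EuclideanSpace ℝ (Fin 3))
        (p : ℝ → EuclideanSpace ℝ (Fin 3) → ℝ),
        IsMaximalSmoothSolution ν 0 u p T ∧ IsLerayHopfOn T ν 0 (u 0) u ∧
        ∀ (q r : ℝ≥0∞), 1 < q → q < ⊤ → 2 / q + 3 / r = 2 → ∀ t₀ ∈ Ico 0 T,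
          ¬ MemLqLp q r (fun t x => curl (u t) x) (Ioo t₀ T) := by
  obtain ⟨ν, hν, T, hT, u, p, hmax, hLH, -⟩ := x5a_of_cascadeWitness' W
  exact ⟨ν, hν, T, hT, u, p, hmax, hLH, vorticity_serrin_face hν hmax hLH⟩

/-- **The two Type-I faces of a cascade witness at its focus** (L43 and L49 on the interface): there is a focus
`x₀` (a point of unbounded velocity in every backward parabolic neighbourhood of `(T, x₀)`) at which (i) with
the absolute `γ` and `S(M)`, `t_*` of `TypeIConcentrationFace.typeI_concentration`, every Morrey Type-I bound forces
`γν < ‖u(t)‖_{L³(B̄(x₀, 2√(ν(T−t)/S)))}` for `t ∈ (t_*, T)`, and (ii) every local Type-I bound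
`√(T−τ)‖u‖ ≤ C` on `(t₁, T) × B(x₀, R)` forces the vorticity direction to admit no modulus of continuity over
`{|ω| > d} ∩ B(x₀, R)` on `(t₁, T)`. [cite: BarkerPrange2020, Thm. 2] [cite: GigaMiura2011, Thm 2.10] -/
theorem typeI_faces_of_cascadeWitness :
    ∃ γ : ℝ, 0 < γ ∧ ∀ M : ℝ, 0 < M → ∃ S : ℝ, 0 < S ∧ S ≤ 1 / 4 ∧
      ∀ W : CascadeWitness, ∃ ν : ℝ, 0 < ν ∧ ∃ T : ℝ, 0 < T ∧
        ∃ (u : ℝ → EuclideanSpace ℝ (Fin 3) → EuclideanSpace ℝ (Fin 3))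
          (p : ℝ → EuclideanSpace ℝ (Fin 3) → ℝ),
          IsMaximalSmoothSolution ν 0 u p T ∧ IsLerayHopfOn T ν 0 (u 0) u ∧
          ∃ x₀ : EuclideanSpace ℝ (Fin 3),
            (∀ r : ℝ, 0 < r → ∀ K : ℝ, ∃ t ∈ Ioo (T - r ^ 2) T, 0 < t ∧ ∃ x ∈ ball x₀ r, K < ‖u t x‖) ∧
            (∀ r₀ : ℝ≥0∞, 0 < r₀ → ∃ tStar : ℝ, 0 ≤ tStar ∧ tStar < T ∧ (r₀ = ∞ → tStar = 0) ∧
              ((∀ (y : EuclideanSpace ℝ (Fin 3)) (r : ℝ), 0 < r → ENNReal.ofReal r < r₀ →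
                  ∀ t : ℝ, 0 < t → T - r ^ 2 / ν < t → t < T →
                    eLpNorm (u t) 2 (volume.restrict (ball y r)) ≤ ENNReal.ofReal (M * ν * Real.sqrt r)) →
                ∀ t ∈ Ioo tStar T,
                  ENNReal.ofReal (γ * ν) <
                    eLpNorm (u t) 3 (volume.restrict (closedBall x₀ (2 * Real.sqrt (ν * (T - t) / S)))))) ∧
            (∀ (t₁ R C : ℝ), t₁ ∈ Ico 0 T → 0 < R → 0 < C →
              (∀ τ ∈ Ioo t₁ T, ∀ x ∈ ball x₀ R, Real.sqrt (T - τ) * ‖u τ x‖ ≤ C) →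
              ∀ (d : ℝ) (η : ℝ → ℝ), 0 < d → MonotoneOn η (Ici 0) → ContinuousOn η (Ici 0) → η 0 = 0 →
                ¬ (∀ τ ∈ Ioo t₁ T, ∀ x ∈ ball x₀ R, ∀ x' ∈ ball x₀ R,
                    d < ‖curl (u τ) x‖ → d < ‖curl (u τ) x'‖ →
                      ‖vorticityDirection (curl (u τ)) x - vorticityDirection (curl (u τ)) x'‖ ≤
                        η ‖x - x'‖)) := by
  obtain ⟨γ, hγ, H⟩ := typeI_concentration
  refine ⟨γ, hγ, fun M hM => ?_⟩
  obtain ⟨S, hS, hS4, HS⟩ := H M hM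
  refine ⟨S, hS, hS4, fun W => ?_⟩
  obtain ⟨ν, hν, T, hT, u, p, hmax, hLH, -⟩ := x5a_of_cascadeWitness' W
  obtain ⟨x₀, hsing⟩ := LocalisationFace.exists_singularPoint hν hT hmax hLH
  refine ⟨ν, hν, T, hT, u, p, hmax, hLH, x₀, hsing, fun r₀ hr₀ => ?_, ?_⟩
  · obtain ⟨tStar, ht0, htT, htop, Hu⟩ := HS ν T hν hT r₀ hr₀
    exact ⟨tStar, ht0, htT, htop, fun hMorrey t ht => Hu u p hmax hLH hMorrey x₀ hsing t ht⟩
  · intro t₁ R C ht₁ hR hC htypeI d η hd hηm hηc hη0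
    exact typeI_direction_no_modulus_at hν hT hmax.1 hLH hsing ht₁ hR hC htypeI hd hηm hηc hη0

/-- **Every cascade witness is the pre-blow-up piece of a global weak continuation with `ℋ^{1/2}`-null singular
times** (L50 on the interface). [cite: Leray1934, §§31–34] -/
theorem continuation_face_of_cascadeWitness (W : CascadeWitness) :
    ∃ ν : ℝ, 0 < ν ∧ ∃ T : ℝ, 0 < T ∧
      ∃ (u : ℝ → EuclideanSpace ℝ (Fin 3) → EuclideanSpace ℝ (Fin 3))
        (p : ℝ → EuclideanSpace ℝ (Fin 3) → ℝ),
        IsMaximalSmoothSolution ν 0 u p T ∧ IsLerayHopfOn T ν 0 (u 0) u ∧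
        ∃ w : ℝ → EuclideanSpace ℝ (Fin 3) → EuclideanSpace ℝ (Fin 3),
          IsGlobalLerayHopf ν 0 (u 0) w ∧ (∀ t ∈ Ioc 0 T, w t = u t) ∧
          (∀ t ∈ Ioo 0 T, ¬ IsSingularTime w t) ∧ IsSingularTime w T ∧
          ∀ T₀ : ℝ, 0 < T₀ → μH[(1 / 2 : ℝ)] {t ∈ Ioo 0 T₀ | IsSingularTime w t} = 0 := by
  obtain ⟨ν, hν, T, hT, u, p, hmax, hLH, -⟩ := x5a_of_cascadeWitness' W
  exact ⟨ν, hν, T, hT, u, p, hmax, hLH, continuation_face hν hT hmax hLH⟩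

end Summit.NavierStokesRegularity.FluidComputer.CascadeWitnessProfileB

end
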